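import Mathlib
import Summits.Ventures.PercRepro2.TypedTwoEdgesAtOKernel
import Summits.Ventures.PercRepro2.TypedClosed

/-!
# The type-2 count of an edge at the mark `b` is «type 1 + pinned open − deleted» (blind cell
PercRepro2, night-3 g17, 2026-08-27; NIGHT3-CERT.md §26.8 — the `b`-twin of TypedOEdgeTypeTwo)

For the kernel `K₃` of (HCOV): let `e = {b, u}` (any `u`) be a typed edge at the mark `b`, `f` any
other typed edge of type `1`, and let every edge at `b` other than `e`, `f` be pinned closed and
untyped.  Then the four counts with `e` of multiplicity `0, 1, 2, 3` satisfy

  `N(τ[e := 2]) = N(τ[e := 1]) + N(τ[e := 3]) − N(τ[e := 0])`   (`typedCount_b_edge_type_two`).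

The mechanism is that of `TypedOEdgeTypeTwo`: every term of `K₃` reads `b` in exactly one copy
(`KB_killB`), so in the two copies not carrying `f` the kernel is affine in the bit of `e`, and the
eight kernel values at the bit patterns of `e` satisfy
`K(110) + K(101) + K(011) + K(000) = K(100) + K(010) + K(001) + K(111)` (`KB_type_two_b_x/y/z`);
census 0 / 37,666 instances at a ≤ 5 (mining/night-3/g17/type2id_b.py).  Own work; standard
axioms.
-/

namespace Summit.Ventures.PercRepro2

namespace CovForm

namespace TypedRed

open OneTyped

/-! ## The kernel identity on states -/

section Kernel

/-- The eight-value identity when the first copy carries `f` (its two states `x0`, `x1` arbitrary,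
the other copies affine in the bit of `e`). -/
lemma KB_type_two_b_x (x0 x1 y w : St) :
    KB x1 y (killB w) + KB x1 (killB y) w + KB x0 y w + KB x0 (killB y) (killB w) =
      KB x1 (killB y) (killB w) + KB x0 y (killB w) + KB x0 (killB y) w + KB x1 y w := by
  have h1 := KB_killB true true false x1 y w
  have h2 := KB_killB true false true x1 y w
  have h3 := KB_killB true true true x0 y w
  have h4 := KB_killB true false false x0 y w
  have h5 := KB_killB true false false x1 y w
  have h6 := KB_killB true true false x0 y w
  have h7 := KB_killB true false true x0 y w
  have h8 := KB_killB true true true x1 y w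
  simp only [cond_true, cond_false, if_true, Bool.false_eq_true, if_false,
    add_zero] at h1 h2 h3 h4 h5 h6 h7 h8
  rw [h1, h2, h3, h4, h5, h6, h7, h8]
  ring

/-- The same with the second copy carrying `f`. -/
lemma KB_type_two_b_y (x y0 y1 w : St) :
    KB x y1 (killB w) + KB (killB x) y1 w + KB x y0 w + KB (killB x) y0 (killB w) =
      KB (killB x) y1 (killB w) + KB x y0 (killB w) + KB (killB x) y0 w + KB x y1 w := by
  have h1 := KB_killB true true false x y1 w
  have h2 := KB_killB false true true x y1 w
  have h3 := KB_killB true true true x y0 w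
  have h4 := KB_killB false true false x y0 w
  have h5 := KB_killB false true false x y1 w
  have h6 := KB_killB true true false x y0 w
  have h7 := KB_killB false true true x y0 w
  have h8 := KB_killB true true true x y1 w
  simp only [cond_true, cond_false, if_true, Bool.false_eq_true, if_false,
    add_zero] at h1 h2 h3 h4 h5 h6 h7 h8
  rw [h1, h2, h3, h4, h5, h6, h7, h8]
  ring

/-- The same with the third copy carrying `f`. -/
lemma KB_type_two_b_z (x y w0 w1 : St) :
    KB x (killB y) w1 + KB (killB x) y w1 + KB x y w0 + KB (killB x) (killB y) w0 =
      KB (killB x) (killB y) w1 + KB x (killB y) w0 + KB (killB x) y w0 + KB x y w1 := by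
  have h1 := KB_killB true false true x y w1
  have h2 := KB_killB false true true x y w1
  have h3 := KB_killB true true true x y w0
  have h4 := KB_killB false false true x y w0
  have h5 := KB_killB false false true x y w1
  have h6 := KB_killB true false true x y w0
  have h7 := KB_killB false true true x y w0
  have h8 := KB_killB true true true x y w1
  simp only [cond_true, cond_false, if_true, Bool.false_eq_true, if_false,
    zero_add] at h1 h2 h3 h4 h5 h6 h7 h8
  rw [h1, h2, h3, h4, h5, h6, h7, h8]
  ring

end Kernel

/-! ## Bookkeeping: the slices of the split at `e` -/

section Sums

variable {R : Type*} [Field R]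

/-- The multiplicity-`0` slice of the split. -/
lemma sum_bool3_bmult0 (T : Bool → Bool → Bool → R) :
    (∑ a : Bool, ∑ b : Bool, ∑ c : Bool, if a.toNat + b.toNat + c.toNat = 0 then T a b c else 0) =
      T false false false := by
  simp only [Fintype.sum_bool, Bool.toNat_true, Bool.toNat_false]
  norm_num

/-- The multiplicity-`2` slice of the split. -/
lemma sum_bool3_bmult2 (T : Bool → Bool → Bool → R) :
    (∑ a : Bool, ∑ b : Bool, ∑ c : Bool, if a.toNat + b.toNat + c.toNat = 2 then T a b c else 0) =
      T true true false + T true false true + T false true true := by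
  simp only [Fintype.sum_bool, Bool.toNat_true, Bool.toNat_false]
  norm_num

/-- The multiplicity-`3` slice of the split. -/
lemma sum_bool3_bmult3 (T : Bool → Bool → Bool → R) :
    (∑ a : Bool, ∑ b : Bool, ∑ c : Bool, if a.toNat + b.toNat + c.toNat = 3 then T a b c else 0) =
      T true true true := by
  simp only [Fintype.sum_bool, Bool.toNat_true, Bool.toNat_false]
  norm_num

end Sums

/-! ## The theorem -/

section Main

open Classical

variable {V : Type*} {E : Type*} [Fintype E] [DecidableEq E] {R : Type*} [Field R]

variable (ends : E → Sym2 V) (o a₁ a₂ a₃ b : V)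

/-- **Type 2 = type 1 + pinned open − deleted** for an edge `e = {b, u}` at the mark `b`: with `f`
any other typed edge of type `1` and every edge at `b` other than `e`, `f` pinned closed and
untyped. -/
theorem typedCount_b_edge_type_two {e f : E} {u : V} (he : ends e = s(b, u))
    (hbu : b ≠ u) (hef : e ≠ f) (hbo : b ≠ o) (hb1 : b ≠ a₁) (hb2 : b ≠ a₂) (hb3 : b ≠ a₃)
    (F : Finset E) (heF : e ∈ F) (hfF : f ∈ F) (z : Config E)
    (τ : E → ℕ) (hτf : τ f = 1)
    (hcl : ∀ e', e' ≠ e → e' ≠ f → b ∈ ends e' → e' ∉ F ∧ z e' = false) :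
    typedCount F z (Function.update τ e 2)
        (K3 ends o a₁ a₂ a₃ b : Config E → Config E → Config E → R) =
      typedCount F z (Function.update τ e 1) (K3 ends o a₁ a₂ a₃ b) +
        typedCount F z (Function.update τ e 3) (K3 ends o a₁ a₂ a₃ b) -
        typedCount F z (Function.update τ e 0) (K3 ends o a₁ a₂ a₃ b) := by
  set K : Config E → Config E → Config E → R := K3 ends o a₁ a₂ a₃ b with hK
  set S := st ends o a₁ a₂ a₃ b with hS
  -- the slices
  have hsl : ∀ k : ℕ, typedCount F z (Function.update τ e k) K =
      ∑ a : Bool, ∑ b : Bool, ∑ c : Bool, if a.toNat + b.toNat + c.toNat = k then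
        typedCount (F.erase e) (Function.update z e false) τ
          (fun x y w => K (Function.update x e a) (Function.update y e b) (Function.update w e c))
        else 0 := by
    intro k
    rw [typedCount_split F e heF z (Function.update τ e k) K, Function.update_self]
    refine Finset.sum_congr rfl fun a _ => Finset.sum_congr rfl fun b _ =>
      Finset.sum_congr rfl fun c _ => ?_
    split_ifs
    · exact typedCount_congr_τ (F.erase e) _
        (fun e' he' => Function.update_of_ne (Finset.ne_of_mem_erase he') _ _) _
    · rfl
  rw [hsl 0, hsl 1, hsl 2, hsl 3, sum_bool3_bmult0, sum_bool3_one, sum_bool3_bmult2, sum_bool3_bmult3]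
  -- the pointwise identity on the support
  have key : typedCount (F.erase e) (Function.update z e false) τ
      (fun x y w =>
        K (Function.update x e true) (Function.update y e true) (Function.update w e false) +
        K (Function.update x e true) (Function.update y e false) (Function.update w e true) +
        K (Function.update x e false) (Function.update y e true) (Function.update w e true) +
        K (Function.update x e false) (Function.update y e false) (Function.update w e false)) =
      typedCount (F.erase e) (Function.update z e false) τ
      (fun x y w =>
        K (Function.update x e true) (Function.update y e false) (Function.update w e false) +
        K (Function.update x e false) (Function.update y e true) (Function.update w e false) +
        K (Function.update x e false) (Function.update y e false) (Function.update w e true) +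
        K (Function.update x e true) (Function.update y e true) (Function.update w e true)) := by
    refine typedCount_congr_K_on _ _ _ fun x y w hxyw hcnt => ?_
    have hfe : f ∈ F.erase e := Finset.mem_erase.2 ⟨hef.symm, hfF⟩
    have hf1 := hcnt f hfe
    rw [hτf] at hf1
    -- the other edges at `b` are closed in every copy
    have hoc : ∀ (x : Config E), (∀ e', e' ∉ F.erase e → x e' = Function.update z e false e') →
        ∀ e', e' ≠ e → e' ≠ f → b ∈ ends e' → x e' = false := by
      intro x hx e' he' hf' ho
      obtain ⟨h1, h2⟩ := hcl e' he' hf' ho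
      have h3 := hx e' (fun h => h1 (Finset.mem_of_mem_erase h))
      rw [Function.update_of_ne he'] at h3
      rw [h3]
      exact h2
    -- a copy with `f` closed: closing `e` isolates `b`
    have hkill : ∀ (x : Config E), (∀ e', e' ∉ F.erase e → x e' = Function.update z e false e') →
        x f = false → S (Function.update x e false) = killB (S (Function.update x e true)) := by
      intro x hx hxf
      refine st_update_closed_b ends o a₁ a₂ a₃ b he hbu hbo hb1 hb2 hb3 (ω := x) ?_
      intro e' he' hb'
      by_cases hf' : e' = f
      · subst hf'; exact hxf
      · exact hoc x hx e' he' hf' hb'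
    simp only [hK, K3_eq_KB, ← hS]
    simp only [openCount] at hf1
    rcases hx : x f with _ | _ <;> rcases hy : y f with _ | _ <;> rcases hw : w f with _ | _ <;>
      simp only [hx, hy, hw, Bool.toNat_true, Bool.toNat_false] at hf1 <;> try omega
    · -- `f` in the third copy
      rw [hkill x (fun e' he' => (hxyw e' he').1) hx, hkill y (fun e' he' => (hxyw e' he').2.1) hy]
      have hz := congrArg (fun n : ℤ => (n : R)) (KB_type_two_b_z (S (Function.update x e true))
        (S (Function.update y e true)) (S (Function.update w e false)) (S (Function.update w e true)))
      push_cast at hz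
      linear_combination hz
    · -- `f` in the second copy
      rw [hkill x (fun e' he' => (hxyw e' he').1) hx, hkill w (fun e' he' => (hxyw e' he').2.2) hw]
      have hz := congrArg (fun n : ℤ => (n : R)) (KB_type_two_b_y (S (Function.update x e true))
        (S (Function.update y e false)) (S (Function.update y e true)) (S (Function.update w e true)))
      push_cast at hz
      linear_combination hz
    · -- `f` in the first copy
      rw [hkill y (fun e' he' => (hxyw e' he').2.1) hy, hkill w (fun e' he' => (hxyw e' he').2.2) hw]
      have hz := congrArg (fun n : ℤ => (n : R)) (KB_type_two_b_x (S (Function.update x e false))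
        (S (Function.update x e true)) (S (Function.update y e true)) (S (Function.update w e true)))
      push_cast at hz
      linear_combination hz
  rw [typedCount_add, typedCount_add, typedCount_add, typedCount_add, typedCount_add,
    typedCount_add] at key
  linear_combination key

end Main

end TypedRed

end CovForm

end Summit.Ventures.PercRepro2
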